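import Literature.NumberTheory.GelbartRogawski1991.LocalSplittingCMParabolicEigenfunctional
import Literature.NumberTheory.GelbartRogawski1991.LocalUnitaryBlockRestriction
import Literature.RepresentationTheory.HeisenbergGroup.SchrodingerPiIrreducible
import Literature.RepresentationTheory.HeisenbergGroup.SchrodingerDirectSum
import Literature.NumberTheory.GelbartRogawski1991.LocalUnitaryUndoublingSplitMixedModel
import Literature.NumberTheory.Automorphic.AdicCompletionLocalField
import HarnessLib

/-!
# The `Δ`-functional of the doubled Schrödinger model: `Δ`-equivariance and transfer between the two blocks

Topic `NumberTheory/GelbartRogawski1991`; namespace `Literature.NumberTheory.GelbartRogawski1991.UnitaryDualPair.LocalSplitting` (that of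
`LocalDoubledUnitaryDatum`, `LocalUnitaryBlockRestriction`, ★ `LocalDoubledDiagonalEigenlaw`), plus one generic lemma in
`Literature.RepresentationTheory.HeisenbergGroup`.  KERNEL ONLY: theorems; no definition, no named fact, no `sorry`, no instance, no notation.
Cell `hodgecm-mathlib` (D-0151), fan B, L1ns road (P) of the crux hLiu418 — brick B2a of the «doubling relation (D)» (memo
`F0/P6/B-p04/g44/MEMO-L1ns-road.v3.B-p04g44.md`); `--supports stmt-HodgeConjecture-24832`, count-neutral.

SETTING: a number field `F`, a finite place `v`, a Gram matrix `T₀ ∈ M_n(F)`, the DOUBLED local Schrödinger model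
`ρ^𝔻 = localSchrodinger F (n+n) (gramD F n T₀) v` on `𝒮(F_v^{n+n})` (`gramD T₀ = T₀ ⊕ᶠ (−T₀)`), its two blocks `ρ_{T₀}`, `ρ_{−T₀}` on `𝒮(F_v^n)`
(product vectors `f₁ ⊠ f₂ = boxSB`, block Heisenberg embeddings ★ `inlH` ∕ `inrH`, ★ `schrodingerSB_inlH_boxSB` ∕ `schrodingerSB_inrH_boxSB`),
the Lagrangian `ℓ_Δ = deltaLagrangian` and an element `m₀ ∈ S̃p_ψ(𝕎^𝔻_v)` whose projection carries `ℓ_Δ` onto `ℓ_Y` (`hm₀`; e.g. Rao's `r(δ′)` of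
★ `localSplittingDatumCM_parabolic`).  The `Δ`-FUNCTIONAL is `λ(Φ) := (ω(m₀) Φ)(0)`.

* §0 `HeisenbergGroup.eq_bot_or_eq_top_of_invariant_schrodingerSB_gram` — irreducibility of the smooth Schrödinger model `ρ_T` of ANY Gram matrix
  with unit determinant (transport of ★ `eq_bot_or_eq_top_of_invariant_schrodingerSB_pi` along ★ `schrodingerSB_gram_eq`). [MVW Chap. 2 I.3]
* §1 **`apply_zero_toRep_schrodinger_of_mem_deltaLagrangian`** — `Δ`-EQUIVARIANCE: `λ(ρ^𝔻(w, t) Φ) = ψ(t) λ(Φ)` for `w ∈ ℓ_Δ` (`ω(m₀)` implements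
  `π(m₀)`, which moves `(w,t)` to `((0,y), t)`: the central shift `½(β(σw,σw) − β(w,w))` vanishes because `ℓ_Δ` and `ℓ_Y` are `β^𝔻`-isotropic,
  `localPairing_gramD_eq_zero_of_mem_deltaLagrangian`).
* §2 **TRANSFER**: `λ((ρ_{T₀}(a) f₁) ⊠ f₂) = ψ(a.t) · λ(f₁ ⊠ ρ_{−T₀}((a.v,0)⁻¹) f₂)` (`apply_zero_toRep_boxSB_schrodinger_left`) and its mirror
  (`…_right`): `(a ⊕ 0)·(0 ⊕ (a.v,0))` is a `Δ`-element with central part `a.t` (`inlH_mul_inrH_v_mem_deltaLagrangian`, `inlH_mul_inrH_t`).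
Sequel (`LocalDoubledDeltaFunctionalNondegenerate`): the pairing `(f₁, f₂) ↦ λ(f₁ ⊠ f₂)` is NON-DEGENERATE (§0 + §2); then (brick B3) with ★ `apply_zero_toRep_boxSB_restrict_diagD` (the diagonal eigen-law of Kudla's CM splitting) this gives the DUALITY OF BLOCK
TYPES «types(restrictRight s^𝔻) = (χ_v∘det)·types(restrictLeft s^𝔻)⁻¹», hence `χ₀² = μ_v²` for the vanishing character of [Liu2021, Lem. D.1 (1)] at an
anisotropic plane.  HC_CM is NOT proved here and is proved only modulo the printed citations (2 remaining named inputs hLiu418, h413) until rung 0 closes.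

## References
* [MoeglinVignerasWaldspurger1987] C. Mœglin, M.-F. Vignéras, J.-L. Waldspurger, LNM 1291 (1987), Chap. 2 I.3 (irreducibility of `𝒮`), II.1 (A), (B),
  Rem. (6) (the doubled space `W ⊕ W⁻` and product vectors).
* [Kudla1994] S. Kudla, *Splitting metaplectic covers of dual reductive pairs*, Israel J. Math. 87 (1994), §2 (doubled space, Siegel parabolic, `Δ`).
* [HarrisKudlaSweet1996] M. Harris, S. Kudla, W. Sweet, J. AMS 9 (1996), §1 (1.9)–(1.11).
* [WeilBNT1967] A. Weil, *Basic Number Theory* (1967), Chap. VII §2 Prop. 2 (products span `𝒮` of a product).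
-/

set_option autoImplicit false

noncomputable section

open scoped Matrix
open NumberField IsDedekindDomain MeasureTheory Matrix
open Literature.RepresentationTheory.HeisenbergGroup
open Literature.NumberTheory.Automorphic Literature.NumberTheory.Automorphic.UnitaryGroup

/-! ## §0 Irreducibility of the smooth Schrödinger model of a Gram matrix (transport of the `dotProduct` case) -/

namespace Literature.RepresentationTheory.HeisenbergGroup

section GramIrreducible

variable {F : Type*} [Field F] [ValuativeRel F] [TopologicalSpace F] [IsNonarchimedeanLocalField F]
  {ι : Type*} [Fintype ι] [DecidableEq ι] (T : Matrix ι ι F) (hT : IsUnit T.det)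
  {ψ : AddChar F Circle} (hl : IsLocallyConstant (⇑ψ : F → Circle))
  (hbT : ∀ y : ι → F, Continuous fun u : ι → F => Matrix.toLinearMap₂' F T u y)

include hT in
/-- **the smooth Schrödinger model `ρ_T` on `𝒮(F^ι)` is irreducible** for every Gram matrix `T` with `det T` a unit: a subspace
stable under every `ρ_T(a)` is `⊥` or `⊤` — transport of ★ `eq_bot_or_eq_top_of_invariant_schrodingerSB_pi` along `e_T : (x,y) ↦ (x,Ty)`
(★ `schrodingerSB_gram_eq`: `ρ_T = ρ_1 ∘ e_T`, `e_T` an isomorphism of Heisenberg groups). [cite: MoeglinVignerasWaldspurger1987, Chap. 2 I.3] -/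
theorem eq_bot_or_eq_top_of_invariant_schrodingerSB_gram (hψ : ψ.IsContinuousNontrivial)
    (W : Submodule ℂ (SchwartzBruhat (ι → F)))
    (hW : ∀ (a : Heisenberg (polar (Matrix.toLinearMap₂' F T))) (f : SchwartzBruhat (ι → F)), f ∈ W →
      schrodingerSB (Matrix.toLinearMap₂' F T) ψ hl hbT a f ∈ W) :
    W = ⊥ ∨ W = ⊤ := by
  refine eq_bot_or_eq_top_of_invariant_schrodingerSB_pi hl continuous_dotProductBilin_left hψ W fun h f hf => ?_
  have key := schrodingerSB_gram_eq T hT hl continuous_dotProductBilin_left hbT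
    ((Heisenberg.mapEquiv (gramProd T hT) (polar_dotProductBilin_gramProd T hT)).symm h)
  rw [MulEquiv.apply_symm_apply] at key
  rw [← key]
  exact hW _ f hf

end GramIrreducible

end Literature.RepresentationTheory.HeisenbergGroup

namespace Literature.NumberTheory.GelbartRogawski1991.UnitaryDualPair.LocalSplitting

/-! ## §1 `Δ`-invariance of the functional `Φ ↦ (ω(m₀) Φ)(0)` -/

section Delta

variable (F : Type) [Field F] [NumberField F] (v : HeightOneSpectrum (𝓞 F)) (n : ℕ) (T₀ : Matrix (Fin n) (Fin n) F)
  (m₀ : LocalMp F (n + n) (gramD F n T₀) v)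
  (hm₀ : (deltaLagrangian F v n).map (toLin F v (MpPsi.proj _ m₀)) = lagrangianY F (n + n) v)


/-- `β^𝔻(X, Y) = 0` on `ℓ_Δ`: the doubled pairing kills diagonal pairs. [cite: HarrisKudlaSweet1996, §1 (1.9), (1.11)] -/
theorem localPairing_gramD_eq_zero_of_mem_deltaLagrangian {w : (Fin (n + n) → (v.adicCompletion F)) × (Fin (n + n) → (v.adicCompletion F))}
    (hw : w ∈ deltaLagrangian F v n) : localPairing F (n + n) (gramD F n T₀) v w.1 w.2 = 0 := by
  rw [localPairing_gramD]
  rw [mem_deltaLagrangian_iff] at hw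
  rw [hw.1, hw.2, sub_self]

include hm₀ in
/-- `m₀` carries `ℓ_Δ` into `ℓ_Y = 0 × F_v^{n+n}`: the first coordinate of `π(m₀) w` vanishes for `w ∈ ℓ_Δ`.
[cite: Kudla1994, §2 (doubled space, Siegel parabolic)] -/
theorem proj_apply_fst_eq_zero_of_mem_deltaLagrangian {w : (Fin (n + n) → (v.adicCompletion F)) × (Fin (n + n) → (v.adicCompletion F))}
    (hw : w ∈ deltaLagrangian F v n) :
    (((MpPsi.proj _ m₀ : LocalSp F (n + n) (gramD F n T₀) v) :
        ((Fin (n + n) → (v.adicCompletion F)) × (Fin (n + n) → (v.adicCompletion F))) ≃ₗ[(v.adicCompletion F)] ((Fin (n + n) → (v.adicCompletion F)) × (Fin (n + n) → (v.adicCompletion F)))) w).1 = 0 := by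
  have hmem : toLin F v (MpPsi.proj _ m₀) w ∈ lagrangianY F (n + n) v := by
    rw [← hm₀]; exact Submodule.mem_map_of_mem hw
  rw [lagrangianY, Submodule.mem_prod, Submodule.mem_bot] at hmem
  exact hmem.1

include hm₀ in
/-- **`Δ`-EQUIVARIANCE**: `(ω(m₀) (ρ^𝔻(h) Φ))(0) = ψ(t) · (ω(m₀) Φ)(0)` for every Heisenberg element `h = (w, t)` with `w ∈ ℓ_Δ` — `ω(m₀)`
implements `π(m₀)`, which carries `h` to an element `((0, y), t)` over `ℓ_Y` (the central shift `½(β(σw,σw) − β(w,w))` vanishes: both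
`ℓ_Y` and `ℓ_Δ` are `β^𝔻`-isotropic), and `(ρ^𝔻((0,y),t) Ψ)(0) = ψ(t) Ψ(0)`. [cite: MoeglinVignerasWaldspurger1987, Chap. 2 II.1 (A)]
[cite: Kudla1994, §2 (doubled space, Siegel parabolic)] -/
theorem apply_zero_toRep_schrodinger_of_mem_deltaLagrangian (h : Heisenberg (polar (localPairing F (n + n) (gramD F n T₀) v)))
    (hv : h.v ∈ deltaLagrangian F v n) (Φ : SchwartzBruhat (Fin (n + n) → (v.adicCompletion F))) :
    ((MpPsi.toRep (localSchrodinger F (n + n) (gramD F n T₀) v) m₀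
          (localSchrodinger F (n + n) (gramD F n T₀) v h Φ) : SchwartzBruhat (Fin (n + n) → (v.adicCompletion F))) :
        (Fin (n + n) → (v.adicCompletion F)) → ℂ) 0 =
      ((adeleAddCharAt F v h.t : Circle) : ℂ) *
        ((MpPsi.toRep (localSchrodinger F (n + n) (gramD F n T₀) v) m₀ Φ : SchwartzBruhat (Fin (n + n) → (v.adicCompletion F))) :
          (Fin (n + n) → (v.adicCompletion F)) → ℂ) 0 := by
  have himp := (mem_MpPsi (localSchrodinger F (n + n) (gramD F n T₀) v) _).1 m₀.2 h Φ
  -- the vector part of `π(m₀) • h` lies in `ℓ_Y`: first coordinate `0`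
  have h1 := proj_apply_fst_eq_zero_of_mem_deltaLagrangian F v n T₀ m₀ hm₀ hv
  rw [MpPsi.proj_apply] at h1
  -- the central shift vanishes: both `ℓ_Δ` and its image `ℓ_Y` are `β^𝔻`-isotropic
  have hf : (ofSymplectic (polar (localPairing F (n + n) (gramD F n T₀) v))
      ((m₀ : LocalSp F (n + n) (gramD F n T₀) v × (SchwartzBruhat (Fin (n + n) → (v.adicCompletion F)) ≃ₗ[ℂ] SchwartzBruhat (Fin (n + n) → (v.adicCompletion F)))).1)).f
      h.v = 0 := by
    rw [ofSymplectic_f, polar_apply, polar_apply, localPairing_gramD_eq_zero_of_mem_deltaLagrangian F v n T₀ hv, h1,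
      LinearMap.map_zero₂, sub_self, mul_zero]
  -- pointwise formula of the local Schrödinger model (`localSchrodinger = schrodingerSB …` definitionally)
  have key : ∀ (h' : Heisenberg (polar (localPairing F (n + n) (gramD F n T₀) v))) (Ψ : SchwartzBruhat (Fin (n + n) → (v.adicCompletion F)))
      (u : Fin (n + n) → (v.adicCompletion F)),
      ((localSchrodinger F (n + n) (gramD F n T₀) v h' Ψ : SchwartzBruhat (Fin (n + n) → (v.adicCompletion F))) : (Fin (n + n) → (v.adicCompletion F)) → ℂ) u =
        ((adeleAddCharAt F v) (h'.t + localPairing F (n + n) (gramD F n T₀) v u h'.v.2) : ℂ) *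
          (Ψ : (Fin (n + n) → (v.adicCompletion F)) → ℂ) (u + h'.v.1) := fun h' Ψ u =>
    schrodingerSB_apply _ _ _ _ h' Ψ u
  rw [MpPsi.toRep_apply, MpPsi.toRep_apply, himp, key]
  -- the central coordinate of `π(m₀) • h` is `t` and the pairing term vanishes
  have ht' : ((ofSymplectic (polar (localPairing F (n + n) (gramD F n T₀) v))
        ((m₀ : LocalSp F (n + n) (gramD F n T₀) v × (SchwartzBruhat (Fin (n + n) → (v.adicCompletion F)) ≃ₗ[ℂ] SchwartzBruhat (Fin (n + n) → (v.adicCompletion F)))).1)).act h).t +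
      localPairing F (n + n) (gramD F n T₀) v 0
        ((ofSymplectic (polar (localPairing F (n + n) (gramD F n T₀) v))
          ((m₀ : LocalSp F (n + n) (gramD F n T₀) v × (SchwartzBruhat (Fin (n + n) → (v.adicCompletion F)) ≃ₗ[ℂ] SchwartzBruhat (Fin (n + n) → (v.adicCompletion F)))).1)).act h).v.2 =
      h.t := by
    rw [Heisenberg.PseudoSymplectic.act_t, hf, add_zero, LinearMap.map_zero₂, add_zero]
  -- the first coordinate of the vector part of `π(m₀) • h` vanishes
  have hv' : (0 : Fin (n + n) → (v.adicCompletion F)) +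
      ((ofSymplectic (polar (localPairing F (n + n) (gramD F n T₀) v))
        ((m₀ : LocalSp F (n + n) (gramD F n T₀) v × (SchwartzBruhat (Fin (n + n) → (v.adicCompletion F)) ≃ₗ[ℂ] SchwartzBruhat (Fin (n + n) → (v.adicCompletion F)))).1)).act h).v.1 =
      0 := by
    rw [Heisenberg.PseudoSymplectic.act_v, ofSymplectic_σ, h1, add_zero]
  rw [ht', hv']

end Delta

/-! ## §2 Block Heisenberg elements: `(ρ₁(a) f₁) ⊠ f₂` versus `f₁ ⊠ (ρ₂(·) f₂)` under the `Δ`-functional -/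

section Blocks

variable (F : Type) [Field F] [NumberField F] (v : HeightOneSpectrum (𝓞 F)) (n : ℕ) (T₀ : Matrix (Fin n) (Fin n) F)
  (m₀ : LocalMp F (n + n) (gramD F n T₀) v)
  (hm₀ : (deltaLagrangian F v n).map (toLin F v (MpPsi.proj _ m₀)) = lagrangianY F (n + n) v)


/-- **the diagonal Heisenberg element `(a ⊕ 0)·(0 ⊕ (a.v, 0))` has vector part in `ℓ_Δ`**. [cite: Kudla1994, §2 (doubled space, Siegel parabolic)] -/
theorem inlH_mul_inrH_v_mem_deltaLagrangian (a : Heisenberg (polar (localPairing F n T₀ v))) :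
    (inlH (e₂ n) (localGram F n T₀ v) (localGram F n (-T₀) v) (localGram_gramD_eq_fromBlocks F v n) a *
        inrH (e₂ n) (localGram F n T₀ v) (localGram F n (-T₀) v) (localGram_gramD_eq_fromBlocks F v n)
          (⟨a.v, 0⟩ : Heisenberg (polar (localPairing F n (-T₀) v)))).v ∈ deltaLagrangian F v n := by
  rw [Heisenberg.mul_v, inlH_v, inrH_v, Prod.mk_add_mk, glue_add, glue_add, mem_deltaLagrangian_iff]
  simp only [add_zero, zero_add]
  refine ⟨funext fun i => ?_, funext fun i => ?_⟩ <;>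
    simp only [halfL, halfR, glue_apply_inl, glue_apply_inr]

/-- … and central part `a.t` (the blocks are `β^𝔻`-orthogonal). [cite: Kudla1994, §2 (doubled space, Siegel parabolic)] -/
theorem inlH_mul_inrH_t (a : Heisenberg (polar (localPairing F n T₀ v))) :
    (inlH (e₂ n) (localGram F n T₀ v) (localGram F n (-T₀) v) (localGram_gramD_eq_fromBlocks F v n) a *
        inrH (e₂ n) (localGram F n T₀ v) (localGram F n (-T₀) v) (localGram_gramD_eq_fromBlocks F v n)
          (⟨a.v, 0⟩ : Heisenberg (polar (localPairing F n (-T₀) v)))).t = a.t := by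
  rw [Heisenberg.mul_t, inlH_t, inrH_t, inlH_v, inrH_v, polar_apply, add_zero]
  dsimp only
  rw [toLinearMap₂'_glue (e₂ n) (localGram F n T₀ v) (localGram F n (-T₀) v) (localGram_gramD_eq_fromBlocks F v n), LinearMap.map_zero₂,
    LinearMap.map_zero, zero_add, add_zero]

include hm₀ in
/-- **TRANSFER ACROSS THE `Δ`-FUNCTIONAL**: `(ω(m₀)((ρ_{T₀}(a) f₁) ⊠ f₂))(0) = ψ(a.t) · (ω(m₀)(f₁ ⊠ ρ_{−T₀}((a.v, 0)⁻¹) f₂))(0)` — write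
`a ⊕ 0 = [(a ⊕ 0)(0 ⊕ (a.v,0))] · (0 ⊕ (a.v,0))⁻¹`, the bracket acts on the functional by `ψ(a.t)` (`Δ`-equivariance), the last factor on the
second tensor factor (★ `schrodingerSB_inlH_boxSB` ∕ `schrodingerSB_inrH_boxSB`). [cite: MoeglinVignerasWaldspurger1987, Chap. 2 II.1 Rem. (6)]
[cite: Kudla1994, §2 (doubled space, Siegel parabolic)] -/
theorem apply_zero_toRep_boxSB_schrodinger_left (a : Heisenberg (polar (localPairing F n T₀ v)))
    (f₁ f₂ : SchwartzBruhat (Fin n → (v.adicCompletion F))) :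
    ((MpPsi.toRep (localSchrodinger F (n + n) (gramD F n T₀) v) m₀
          (boxSB (v.adicCompletion F) (e₂ n) (localSchrodinger F n T₀ v a f₁) f₂) : SchwartzBruhat (Fin (n + n) → (v.adicCompletion F))) : (Fin (n + n) → (v.adicCompletion F)) → ℂ) 0 =
      ((adeleAddCharAt F v a.t : Circle) : ℂ) *
        ((MpPsi.toRep (localSchrodinger F (n + n) (gramD F n T₀) v) m₀
            (boxSB (v.adicCompletion F) (e₂ n) f₁ (localSchrodinger F n (-T₀) v (⟨a.v, 0⟩ : Heisenberg (polar (localPairing F n (-T₀) v)))⁻¹ f₂)) :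
          SchwartzBruhat (Fin (n + n) → (v.adicCompletion F))) : (Fin (n + n) → (v.adicCompletion F)) → ℂ) 0 := by
  -- `ρ^𝔻(a ⊕ 0)(f₁ ⊠ f₂) = ρ_{T₀}(a) f₁ ⊠ f₂`, `ρ^𝔻(0 ⊕ b)(f₁ ⊠ f₂) = f₁ ⊠ ρ_{−T₀}(b) f₂`
  have hinl : ∀ (a' : Heisenberg (polar (localPairing F n T₀ v))) (g₁ g₂ : SchwartzBruhat (Fin n → (v.adicCompletion F))),
      localSchrodinger F (n + n) (gramD F n T₀) v
          (inlH (e₂ n) (localGram F n T₀ v) (localGram F n (-T₀) v) (localGram_gramD_eq_fromBlocks F v n) a') (boxSB (v.adicCompletion F) (e₂ n) g₁ g₂) =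
        boxSB (v.adicCompletion F) (e₂ n) (localSchrodinger F n T₀ v a' g₁) g₂ := fun a' g₁ g₂ =>
    schrodingerSB_inlH_boxSB (e₂ n) (localGram F n T₀ v) (localGram F n (-T₀) v) (localGram_gramD_eq_fromBlocks F v n)
      (isLocallyConstant_of_isContinuousNontrivial (isContinuousNontrivial_adeleAddCharAt F v))
      (continuous_toLinearMap₂'_left (localGram F n T₀ v)) (continuous_toLinearMap₂'_left (localGram F (n + n) (gramD F n T₀) v)) a' g₁ g₂
  have hinr : ∀ (b : Heisenberg (polar (localPairing F n (-T₀) v))) (g₁ g₂ : SchwartzBruhat (Fin n → (v.adicCompletion F))),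
      localSchrodinger F (n + n) (gramD F n T₀) v
          (inrH (e₂ n) (localGram F n T₀ v) (localGram F n (-T₀) v) (localGram_gramD_eq_fromBlocks F v n) b) (boxSB (v.adicCompletion F) (e₂ n) g₁ g₂) =
        boxSB (v.adicCompletion F) (e₂ n) g₁ (localSchrodinger F n (-T₀) v b g₂) := fun b g₁ g₂ =>
    schrodingerSB_inrH_boxSB (e₂ n) (localGram F n T₀ v) (localGram F n (-T₀) v) (localGram_gramD_eq_fromBlocks F v n)
      (isLocallyConstant_of_isContinuousNontrivial (isContinuousNontrivial_adeleAddCharAt F v))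
      (continuous_toLinearMap₂'_left (localGram F n (-T₀) v)) (continuous_toLinearMap₂'_left (localGram F (n + n) (gramD F n T₀) v)) b g₁ g₂
  -- the factorisation `a ⊕ 0 = [(a ⊕ 0)(0 ⊕ b)] · (0 ⊕ b)⁻¹`, `b = (a.v, 0)`
  have e1 : localSchrodinger F (n + n) (gramD F n T₀) v
        (inlH (e₂ n) (localGram F n T₀ v) (localGram F n (-T₀) v) (localGram_gramD_eq_fromBlocks F v n) a) (boxSB (v.adicCompletion F) (e₂ n) f₁ f₂) =
      localSchrodinger F (n + n) (gramD F n T₀) v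
        (inlH (e₂ n) (localGram F n T₀ v) (localGram F n (-T₀) v) (localGram_gramD_eq_fromBlocks F v n) a *
          inrH (e₂ n) (localGram F n T₀ v) (localGram F n (-T₀) v) (localGram_gramD_eq_fromBlocks F v n)
            (⟨a.v, 0⟩ : Heisenberg (polar (localPairing F n (-T₀) v))))
        (localSchrodinger F (n + n) (gramD F n T₀) v
          (inrH (e₂ n) (localGram F n T₀ v) (localGram F n (-T₀) v) (localGram_gramD_eq_fromBlocks F v n)
            ((⟨a.v, 0⟩ : Heisenberg (polar (localPairing F n (-T₀) v)))⁻¹)) (boxSB (v.adicCompletion F) (e₂ n) f₁ f₂)) := by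
    rw [← Module.End.mul_apply, ← map_mul, map_inv, mul_inv_cancel_right]
  have e2 := apply_zero_toRep_schrodinger_of_mem_deltaLagrangian F v n T₀ m₀ hm₀ _ (inlH_mul_inrH_v_mem_deltaLagrangian F v n T₀ a)
    (localSchrodinger F (n + n) (gramD F n T₀) v
      (inrH (e₂ n) (localGram F n T₀ v) (localGram F n (-T₀) v) (localGram_gramD_eq_fromBlocks F v n)
        ((⟨a.v, 0⟩ : Heisenberg (polar (localPairing F n (-T₀) v)))⁻¹)) (boxSB (v.adicCompletion F) (e₂ n) f₁ f₂))
  -- assemble by explicit congruences (no `rw` through the large operator terms)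
  refine (congrArg (fun Φ : SchwartzBruhat (Fin (n + n) → (v.adicCompletion F)) =>
      ((MpPsi.toRep (localSchrodinger F (n + n) (gramD F n T₀) v) m₀ Φ : SchwartzBruhat (Fin (n + n) → (v.adicCompletion F))) : (Fin (n + n) → (v.adicCompletion F)) → ℂ) 0)
    ((hinl a f₁ f₂).symm.trans e1)).trans (e2.trans ?_)
  exact congrArg₂ (fun (t : (v.adicCompletion F)) (Φ : SchwartzBruhat (Fin (n + n) → (v.adicCompletion F))) => ((adeleAddCharAt F v t : Circle) : ℂ) *
      ((MpPsi.toRep (localSchrodinger F (n + n) (gramD F n T₀) v) m₀ Φ : SchwartzBruhat (Fin (n + n) → (v.adicCompletion F))) : (Fin (n + n) → (v.adicCompletion F)) → ℂ) 0)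
    (inlH_mul_inrH_t F v n T₀ a) (hinr ((⟨a.v, 0⟩ : Heisenberg (polar (localPairing F n (-T₀) v)))⁻¹) f₁ f₂)

/-- the diagonal Heisenberg element `(0 ⊕ b)·((b.v, 0) ⊕ 0)` has vector part in `ℓ_Δ`. [cite: Kudla1994, §2 (doubled space, Siegel parabolic)] -/
theorem inrH_mul_inlH_v_mem_deltaLagrangian (b : Heisenberg (polar (localPairing F n (-T₀) v))) :
    (inrH (e₂ n) (localGram F n T₀ v) (localGram F n (-T₀) v) (localGram_gramD_eq_fromBlocks F v n) b *
        inlH (e₂ n) (localGram F n T₀ v) (localGram F n (-T₀) v) (localGram_gramD_eq_fromBlocks F v n)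
          (⟨b.v, 0⟩ : Heisenberg (polar (localPairing F n T₀ v)))).v ∈ deltaLagrangian F v n := by
  rw [Heisenberg.mul_v, inlH_v, inrH_v, Prod.mk_add_mk, glue_add, glue_add, mem_deltaLagrangian_iff]
  simp only [add_zero, zero_add]
  refine ⟨funext fun i => ?_, funext fun i => ?_⟩ <;>
    simp only [halfL, halfR, glue_apply_inl, glue_apply_inr]

/-- … and central part `b.t`. [cite: Kudla1994, §2 (doubled space, Siegel parabolic)] -/
theorem inrH_mul_inlH_t (b : Heisenberg (polar (localPairing F n (-T₀) v))) :
    (inrH (e₂ n) (localGram F n T₀ v) (localGram F n (-T₀) v) (localGram_gramD_eq_fromBlocks F v n) b *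
        inlH (e₂ n) (localGram F n T₀ v) (localGram F n (-T₀) v) (localGram_gramD_eq_fromBlocks F v n)
          (⟨b.v, 0⟩ : Heisenberg (polar (localPairing F n T₀ v)))).t = b.t := by
  rw [Heisenberg.mul_t, inlH_t, inrH_t, inlH_v, inrH_v, polar_apply, add_zero]
  dsimp only
  rw [toLinearMap₂'_glue (e₂ n) (localGram F n T₀ v) (localGram F n (-T₀) v) (localGram_gramD_eq_fromBlocks F v n), LinearMap.map_zero₂,
    LinearMap.map_zero, add_zero, add_zero]

include hm₀ in
/-- **TRANSFER ACROSS THE `Δ`-FUNCTIONAL, second block**: `(ω(m₀)(f₁ ⊠ ρ_{−T₀}(b) f₂))(0) = ψ(b.t) · (ω(m₀)(ρ_{T₀}((b.v,0)⁻¹) f₁ ⊠ f₂))(0)`.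
[cite: MoeglinVignerasWaldspurger1987, Chap. 2 II.1 Rem. (6)] [cite: Kudla1994, §2 (doubled space, Siegel parabolic)] -/
theorem apply_zero_toRep_boxSB_schrodinger_right (b : Heisenberg (polar (localPairing F n (-T₀) v)))
    (f₁ f₂ : SchwartzBruhat (Fin n → (v.adicCompletion F))) :
    ((MpPsi.toRep (localSchrodinger F (n + n) (gramD F n T₀) v) m₀
          (boxSB (v.adicCompletion F) (e₂ n) f₁ (localSchrodinger F n (-T₀) v b f₂)) : SchwartzBruhat (Fin (n + n) → (v.adicCompletion F))) : (Fin (n + n) → (v.adicCompletion F)) → ℂ) 0 =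
      ((adeleAddCharAt F v b.t : Circle) : ℂ) *
        ((MpPsi.toRep (localSchrodinger F (n + n) (gramD F n T₀) v) m₀
            (boxSB (v.adicCompletion F) (e₂ n) (localSchrodinger F n T₀ v (⟨b.v, 0⟩ : Heisenberg (polar (localPairing F n T₀ v)))⁻¹ f₁) f₂) :
          SchwartzBruhat (Fin (n + n) → (v.adicCompletion F))) : (Fin (n + n) → (v.adicCompletion F)) → ℂ) 0 := by
  have hinl : ∀ (a' : Heisenberg (polar (localPairing F n T₀ v))) (g₁ g₂ : SchwartzBruhat (Fin n → (v.adicCompletion F))),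
      localSchrodinger F (n + n) (gramD F n T₀) v
          (inlH (e₂ n) (localGram F n T₀ v) (localGram F n (-T₀) v) (localGram_gramD_eq_fromBlocks F v n) a') (boxSB (v.adicCompletion F) (e₂ n) g₁ g₂) =
        boxSB (v.adicCompletion F) (e₂ n) (localSchrodinger F n T₀ v a' g₁) g₂ := fun a' g₁ g₂ =>
    schrodingerSB_inlH_boxSB (e₂ n) (localGram F n T₀ v) (localGram F n (-T₀) v) (localGram_gramD_eq_fromBlocks F v n)
      (isLocallyConstant_of_isContinuousNontrivial (isContinuousNontrivial_adeleAddCharAt F v))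
      (continuous_toLinearMap₂'_left (localGram F n T₀ v)) (continuous_toLinearMap₂'_left (localGram F (n + n) (gramD F n T₀) v)) a' g₁ g₂
  have hinr : ∀ (b' : Heisenberg (polar (localPairing F n (-T₀) v))) (g₁ g₂ : SchwartzBruhat (Fin n → (v.adicCompletion F))),
      localSchrodinger F (n + n) (gramD F n T₀) v
          (inrH (e₂ n) (localGram F n T₀ v) (localGram F n (-T₀) v) (localGram_gramD_eq_fromBlocks F v n) b') (boxSB (v.adicCompletion F) (e₂ n) g₁ g₂) =
        boxSB (v.adicCompletion F) (e₂ n) g₁ (localSchrodinger F n (-T₀) v b' g₂) := fun b' g₁ g₂ =>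
    schrodingerSB_inrH_boxSB (e₂ n) (localGram F n T₀ v) (localGram F n (-T₀) v) (localGram_gramD_eq_fromBlocks F v n)
      (isLocallyConstant_of_isContinuousNontrivial (isContinuousNontrivial_adeleAddCharAt F v))
      (continuous_toLinearMap₂'_left (localGram F n (-T₀) v)) (continuous_toLinearMap₂'_left (localGram F (n + n) (gramD F n T₀) v)) b' g₁ g₂
  -- the factorisation `0 ⊕ b = [(0 ⊕ b)(c ⊕ 0)] · (c ⊕ 0)⁻¹`, `c = (b.v, 0)`
  have e1 : localSchrodinger F (n + n) (gramD F n T₀) v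
        (inrH (e₂ n) (localGram F n T₀ v) (localGram F n (-T₀) v) (localGram_gramD_eq_fromBlocks F v n) b) (boxSB (v.adicCompletion F) (e₂ n) f₁ f₂) =
      localSchrodinger F (n + n) (gramD F n T₀) v
        (inrH (e₂ n) (localGram F n T₀ v) (localGram F n (-T₀) v) (localGram_gramD_eq_fromBlocks F v n) b *
          inlH (e₂ n) (localGram F n T₀ v) (localGram F n (-T₀) v) (localGram_gramD_eq_fromBlocks F v n)
            (⟨b.v, 0⟩ : Heisenberg (polar (localPairing F n T₀ v))))
        (localSchrodinger F (n + n) (gramD F n T₀) v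
          (inlH (e₂ n) (localGram F n T₀ v) (localGram F n (-T₀) v) (localGram_gramD_eq_fromBlocks F v n)
            ((⟨b.v, 0⟩ : Heisenberg (polar (localPairing F n T₀ v)))⁻¹)) (boxSB (v.adicCompletion F) (e₂ n) f₁ f₂)) := by
    rw [← Module.End.mul_apply, ← map_mul, map_inv, mul_inv_cancel_right]
  have e2 := apply_zero_toRep_schrodinger_of_mem_deltaLagrangian F v n T₀ m₀ hm₀ _ (inrH_mul_inlH_v_mem_deltaLagrangian F v n T₀ b)
    (localSchrodinger F (n + n) (gramD F n T₀) v
      (inlH (e₂ n) (localGram F n T₀ v) (localGram F n (-T₀) v) (localGram_gramD_eq_fromBlocks F v n)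
        ((⟨b.v, 0⟩ : Heisenberg (polar (localPairing F n T₀ v)))⁻¹)) (boxSB (v.adicCompletion F) (e₂ n) f₁ f₂))
  refine (congrArg (fun Φ : SchwartzBruhat (Fin (n + n) → (v.adicCompletion F)) =>
      ((MpPsi.toRep (localSchrodinger F (n + n) (gramD F n T₀) v) m₀ Φ : SchwartzBruhat (Fin (n + n) → (v.adicCompletion F))) : (Fin (n + n) → (v.adicCompletion F)) → ℂ) 0)
    ((hinr b f₁ f₂).symm.trans e1)).trans (e2.trans ?_)
  exact congrArg₂ (fun (t : (v.adicCompletion F)) (Φ : SchwartzBruhat (Fin (n + n) → (v.adicCompletion F))) => ((adeleAddCharAt F v t : Circle) : ℂ) *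
      ((MpPsi.toRep (localSchrodinger F (n + n) (gramD F n T₀) v) m₀ Φ : SchwartzBruhat (Fin (n + n) → (v.adicCompletion F))) : (Fin (n + n) → (v.adicCompletion F)) → ℂ) 0)
    (inrH_mul_inlH_t F v n T₀ b) (hinl ((⟨b.v, 0⟩ : Heisenberg (polar (localPairing F n T₀ v)))⁻¹) f₁ f₂)

end Blocks

end Literature.NumberTheory.GelbartRogawski1991.UnitaryDualPair.LocalSplitting

end
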